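import Summits.ValiantsHypothesis.ValiantsHypothesis.Theorems.SymPencilPerFourSingularLocusSupportPatterns
import Summits.ValiantsHypothesis.ValiantsHypothesis.Theorems.SymPencilPerFourSixDimExotic
import Mathlib.Algebra.Module.Submodule.Union
import Mathlib.Algebra.CharZero.Infinite

/-!
# Route `SymPencil` — SING-SIX CLASSIFICATION, Theorem A (T6′): every `6`-dimensional linear
# subspace of `Sing Z(per₄)` lies in a cross, has two zero rows / columns, or is an exotic
# one-zero-line family `V_λ`, `V^gr` (ᵀ) — VERBATIM port, part 1/10 (`--supports`
# stmt-ValiantsHypothesis-5674 `SdcSuperquadratic`; rung currency only, nothing here bears on `VP ≠ VNP`)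

PORT NOTE (val-width-5674-w2 g0′, helper mode; director-valiant R223 (a)): part 1/10 of a VERBATIM
port of val-idea-18 g3/g4's SORRY-FREE Theorem A of `Cruxes/SdcSuperquadratic/Lines/
sing_six_classification.lean` rev 2.6 (sha256 dfb5f805c61d14b7…; here: `Sing3` … `LemmaPhi`).
ALL mathematics and proofs are val-idea-18's (memo `SING-SIX-CLASSIFICATION.md`); the port changes
only the file split, the linear import chain, the namespace, and one-line docstrings on API lemmas.
NOT ported: the `sorry`-stubs of LIST leaves 3–5 and `sixDim_perDir_list` (leaves 3, 4 = landed
`SymPencilPerFourExoticNoSixSquares` / `SymPencilPerFourCrossFilter`; leaf 5 open).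
  Cut table: see part 10 (`…TheoremA`).
Honest label: Theorem A of a line, not the crux, not the LIST; `27 ≤ sdc(per₄) ≤ 29` unchanged; stmt-5674
open; `VP ≠ VNP` not moved; no summit statement is proved here. [folklore]
-/

noncomputable section
set_option linter.dupNamespace false
set_option linter.unusedVariables false
set_option linter.unusedSectionVars false

namespace Summit.ValiantsHypothesis.ValiantsHypothesis.Theorems.SymPencilSingSixClassification

open MvPolynomial Module Literature.Computability.AlgebraicComplexity
variable {K : Type*} [Field K]

/-- `W ⊆ Sing Z(per₄)`: all `3 × 3` subpermanents vanish on `W` (the tree's convention). -/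
def Sing3 (W : Submodule K (Fin 4 × Fin 4 → K)) : Prop :=
  ∀ x ∈ W, ∀ (r c : Fin 3 → Fin 4), Function.Injective r → Function.Injective c →
    ((Matrix.of fun i j => x (i, j)).submatrix r c).permanent = 0

/-- Per-direction family of `≤ 6` squares: for every `y ∈ W` the `s²`-coefficient of
`per₄ (u + s y)` is `Σ_{k<6} c_k Λ_k(u)²` (pad with `c_k = 0`; necessary for the joint six-square
family of cell `(10,6,6)`, cf. `SymPencilPerFourSixDimJointSix`). -/
def PerDirSix (W : Submodule K (Fin 4 × Fin 4 → K)) : Prop :=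
  ∀ y ∈ W, ∃ (c : Fin 6 → K) (Λ : Fin 6 → ((Fin 4 × Fin 4 → K) →ₗ[K] K)),
    ∀ u : Fin 4 × Fin 4 → K, ∃ e₀ e₁ : K, ∀ s : K,
      eval (u + s • y) (perPoly (Fin 4) K) = e₀ + s * e₁ + s ^ 2 * ∑ k, c k * (Λ k u) ^ 2

/-- `W` lies in the cross `X_{lc} = row l ∪ column c`. -/
def InCross (W : Submodule K (Fin 4 × Fin 4 → K)) : Prop :=
  ∃ l c : Fin 4, ∀ x ∈ W, ∀ i j : Fin 4, i ≠ l → j ≠ c → x (i, j) = 0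

/-- Two identically-zero rows on `W`. -/
def TwoZeroRows (W : Submodule K (Fin 4 × Fin 4 → K)) : Prop :=
  ∃ p q : Fin 4, p ≠ q ∧ ∀ x ∈ W, ∀ j : Fin 4, x (p, j) = 0 ∧ x (q, j) = 0

/-- Two identically-zero columns on `W`. -/
def TwoZeroCols (W : Submodule K (Fin 4 × Fin 4 → K)) : Prop :=
  ∃ p q : Fin 4, p ≠ q ∧ ∀ x ∈ W, ∀ i : Fin 4, x (i, p) = 0 ∧ x (i, q) = 0

/-- `W = V_λ` up to `S₄ × S₄`: zero row `ρ 0`, free row `ρ 1`, row `ρ 2 ∈ K(α e_{γ0} + β e_{γ1})`,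
row `ρ 3 ∈ K(α e_{γ0} − β e_{γ1})`, `αβ ≠ 0` (`SymPencilPerFourSixDimExotic`: `ρ = γ = 1`, `α = β = 1`). -/
def VLambdaRows (W : Submodule K (Fin 4 × Fin 4 → K)) : Prop :=
  ∃ (ρ γ : Equiv.Perm (Fin 4)) (α β : K), α ≠ 0 ∧ β ≠ 0 ∧
    ∀ x : Fin 4 × Fin 4 → K, x ∈ W ↔
      ((∀ j, x (ρ 0, j) = 0) ∧
       (∃ s : K, ∀ j, x (ρ 2, γ j) = s * ![α, β, 0, 0] j) ∧
       (∃ t : K, ∀ j, x (ρ 3, γ j) = t * ![α, -β, 0, 0] j))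

/-- Transposed `V_λ`: zero column `γ 0`, free column `γ 1`, columns `γ 2, γ 3` as above. -/
def VLambdaCols (W : Submodule K (Fin 4 × Fin 4 → K)) : Prop :=
  ∃ (ρ γ : Equiv.Perm (Fin 4)) (α β : K), α ≠ 0 ∧ β ≠ 0 ∧
    ∀ x : Fin 4 × Fin 4 → K, x ∈ W ↔
      ((∀ i, x (i, γ 0) = 0) ∧
       (∃ s : K, ∀ i, x (ρ i, γ 2) = s * ![α, β, 0, 0] i) ∧
       (∃ t : K, ∀ i, x (ρ i, γ 3) = t * ![α, -β, 0, 0] i))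

/-- `W = V^gr` up to `S₄ × S₄` (NEW exotic family): zero row `ρ 0`, free row `ρ 1`, rows `ρ 2, ρ 3`
supported on columns `γ 0, γ 1` with `x_{ρ3,γ0} = c₀ x_{ρ2,γ0}`, `x_{ρ3,γ1} = −c₀ x_{ρ2,γ1}`, `c₀ ≠ 0`;
i.e. `row ρ1 ⊕ K(E_{ρ2,γ0} + c₀E_{ρ3,γ0}) ⊕ K(E_{ρ2,γ1} − c₀E_{ρ3,γ1})`. -/
def VGraphRows (W : Submodule K (Fin 4 × Fin 4 → K)) : Prop :=
  ∃ (ρ γ : Equiv.Perm (Fin 4)) (c₀ : K), c₀ ≠ 0 ∧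
    ∀ x : Fin 4 × Fin 4 → K, x ∈ W ↔
      ((∀ j, x (ρ 0, j) = 0) ∧
       x (ρ 2, γ 2) = 0 ∧ x (ρ 2, γ 3) = 0 ∧ x (ρ 3, γ 2) = 0 ∧ x (ρ 3, γ 3) = 0 ∧
       x (ρ 3, γ 0) = c₀ * x (ρ 2, γ 0) ∧ x (ρ 3, γ 1) = -(c₀ * x (ρ 2, γ 1)))

/-- Transposed `V^gr`. -/
def VGraphCols (W : Submodule K (Fin 4 × Fin 4 → K)) : Prop :=
  ∃ (ρ γ : Equiv.Perm (Fin 4)) (c₀ : K), c₀ ≠ 0 ∧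
    ∀ x : Fin 4 × Fin 4 → K, x ∈ W ↔
      ((∀ i, x (i, γ 0) = 0) ∧
       x (ρ 2, γ 2) = 0 ∧ x (ρ 3, γ 2) = 0 ∧ x (ρ 2, γ 3) = 0 ∧ x (ρ 3, γ 3) = 0 ∧
       x (ρ 0, γ 3) = c₀ * x (ρ 0, γ 2) ∧ x (ρ 1, γ 3) = -(c₀ * x (ρ 1, γ 2)))

/-- `V×`-type: `W = X_{lc} ∩ {x_e = 0}` for an ARM cell `e ∈ (row l ∪ column c) ∖ {(l,c)}`
(`SymPencilPerFourSixDimJointSix`: `l = c = 0`, `e = (3,0)`). -/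
def VCrossType (W : Submodule K (Fin 4 × Fin 4 → K)) : Prop :=
  ∃ (l c : Fin 4) (e : Fin 4 × Fin 4), (e.1 = l ∨ e.2 = c) ∧ e ≠ (l, c) ∧
    ∀ x : Fin 4 × Fin 4 → K, x ∈ W ↔
      ((∀ i j : Fin 4, i ≠ l → j ≠ c → x (i, j) = 0) ∧ x e = 0)

/-- `W_col`-type: `W = rows{p,q} × (the three columns ≠ m)` (`SymPencilPerFourColSix`: `p,q = 0,1`, `m = 0`). -/
def WColType (W : Submodule K (Fin 4 × Fin 4 → K)) : Prop :=
  ∃ p q m : Fin 4, p ≠ q ∧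
    ∀ x : Fin 4 × Fin 4 → K, x ∈ W ↔
      ((∀ i j : Fin 4, i ≠ p → i ≠ q → x (i, j) = 0) ∧ x (p, m) = 0 ∧ x (q, m) = 0)

/-- Transposed `W_col`-type: `W = cols{p,q} × (the three rows ≠ m)`. -/
def WColTypeT (W : Submodule K (Fin 4 × Fin 4 → K)) : Prop :=
  ∃ p q m : Fin 4, p ≠ q ∧
    ∀ x : Fin 4 × Fin 4 → K, x ∈ W ↔
      ((∀ i j : Fin 4, j ≠ p → j ≠ q → x (i, j) = 0) ∧ x (m, p) = 0 ∧ x (m, q) = 0)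

/-- `W₂`-type: row `p` free, row `q` vanishing at the two columns `m ≠ m'`, all other rows zero
(`PENCIL-CROSS-27.md` §W₂: `p,q = 0,1`, row `1 ⊆ span(E₁₀,E₁₁)`). -/
def W2Type (W : Submodule K (Fin 4 × Fin 4 → K)) : Prop :=
  ∃ p q m m' : Fin 4, p ≠ q ∧ m ≠ m' ∧
    ∀ x : Fin 4 × Fin 4 → K, x ∈ W ↔
      ((∀ i j : Fin 4, i ≠ p → i ≠ q → x (i, j) = 0) ∧ x (q, m) = 0 ∧ x (q, m') = 0)

/-- Transposed `W₂`-type: column `p` free, column `q` vanishing at the two rows `m ≠ m'`. -/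
def W2TypeT (W : Submodule K (Fin 4 × Fin 4 → K)) : Prop :=
  ∃ p q m m' : Fin 4, p ≠ q ∧ m ≠ m' ∧
    ∀ x : Fin 4 × Fin 4 → K, x ∈ W ↔
      ((∀ i j : Fin 4, j ≠ p → j ≠ q → x (i, j) = 0) ∧ x (m, q) = 0 ∧ x (m', q) = 0)

/-! ## The leaves (paper-proved in the memo; `sorry` here) — leaf 2 is split further below -/

/-! ## Leaf 2 — the one-zero-line residue: SECOND-LEVEL SPLIT (rev 2/2.1, val-idea-18 g4; price P1 of val-idea-crit-5 VERDICT #5 / R194 (a))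

The `L`-sized leaf `stub_zeroLineResidue` of rev 1 is now the DERIVED theorem `zeroLineResidue`
(sorry-free composition) of the typed cascade below.  Normal form: `NormSix W` = `W` singular,
`6`-dimensional, row `0` identically zero; the three live rows are addressed through a permutation `ρ`
of `Fin 4` with `ρ 0 = 0` (`r, s, t = ρ 1, ρ 2, ρ 3`); `A_i = W.map (rowL i)` (row space, `n_i` its
dimension), `K_r = W ⊓ ker (rowL r)` (kernel plane).

TREE (memo §3; every `stub_*` is ONE leaf; sizes are Lean guesses S ≈ ½ day, M ≈ 1–2 days, L ≈ 3+ days):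
* `zeroLineResidue_of : Transport → CaseFour → CaseThree → ToricStructure → ToricTriple → leaf 2`
  (PROVED: the trichotomy `some n_r = 4 ∨ (all ≤ 3, some = 3) ∨ all n_r ≤ 2` and the toric glue);
* `caseFour_of : PerpPlanes → CasePure → CaseProduct → CaseGraph → CaseFour`
  (PROVED: `dim K_r = 2` by rank–nullity, POLARISATION §3.1 (`polar`, PROVED) makes every element of
  `K_r` a perm-orthogonal pair of rows, and the four kernel-plane types of `PerpPlanes` are dispatched,
  the second pure type through `ρ ∘ (2 3)`);
* `pureCore_of : SBShape → LemmaPhi → PureCore` (PROVED, unused since rev 2.4) and `pureCore : PureCore`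
  (PROVED rev 2.4 from the absorption master lemma `T3_absorb_all` / `permOrth_absorb`);
* TOOLS (self-contained algebra over `K⁴`, no `W`): `permOrthPairs` (§3.3, PROVED rev 2.1),
  `productAbsorb` (§3.5 / C12, PROVED rev 2.4: transport `T3_perm` to `j = 0, c = 1` + a `16`-unknown
  linear system), `graphAbsorb_of : ProductAbsorb → GraphAbsorb` (C13, PROVED rev 2.4: `χ ± e φ` are
  absorbed by `e_j`, `e_c`), `perpPlanes : PermOrthPairs → PerpPlanes` (§3.3 rulings + covering,
  PROVED rev 2.5), `toricTriple : PermOrthPairs → ToricTriple` (§3.8, PROVED rev 2.5 by the kernel-pair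
  lemma `smallKer` + `coordPair_of_cover` + `toric_caseI`; no `SBShape` — `SBShape`, `LemmaPhi` remain
  as `def`s only);
* CASES (`W`-level; each ≤ one page on paper GIVEN its tool, which it takes as hypothesis):
  `casePure_of : PureCore → CasePure` (§3.6 (i), PROVED rev 2.2), `caseProduct_of : ProductAbsorb →
  CaseProduct` (§3.6 (ii), PROVED rev 2.3), `caseGraph_of : GraphAbsorb → CaseGraph` (§3.6 (iii),
  PROVED rev 2.3), `caseThree_of : PerpPlanes → CaseThree` (§3.7, PROVED rev 2.3 via the rank drop
  `permOrth_of_T3_on` and `kerPlane_pure_of_three`); `toricStructure` (§3.8, linear algebra) and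
  `transport` (`S₄ × S₄ × ⟨ᵀ⟩` transport to the normal form) are PROVED (rev 2.1).
REMAINING residue stubs: NONE (rev 2.5) — leaf 2 is closed; leaf 1 is closed too (rev 2.6, section «Leaf 1»
below), so THEOREM A `sixDim_classification` is sorry-free; the skeleton's open stubs are the LIST leaves 3, 4, 5.
Conventions: `pairPerm v w p q = v_p w_q + v_q w_p` (the memo's `m_{pq}(v,w)`), `T3 u v w l` = the
`3 × 3` permanent of the rows `u, v, w` off column `l` (`= (P(v,w)u)_l`; symmetric, trilinear —
PROVED), `PermOrth v w` = `v ⊥ w`.  The memo's COMPLEMENTARY arrangement `P(v,w)_{ab} = m_{{a,b}ᶜ}(v,w)`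
is spelled out where it matters (`SBShape`, `LemmaPhi`).  Exact sanity checks of the four freshly
typed tool statements in exactly these conventions: `leaf2_stub_checks.py` (evidence on stmt-5674;
C12′ ProductAbsorb incl. `αβ = 0`, C13′ GraphAbsorb, 3.2′ SBShape on 655 random/sparse planes + all
shapes, 3.4′ LemmaPhi for shapes 0/C1/C2/C3/C3′: 4/4 PASS).  [folklore] -/

/-! ### Notation for the residue cascade -/

/-- Row `i` of a `4 × 4` array. -/
def row (x : Fin 4 × Fin 4 → K) (i : Fin 4) : Fin 4 → K := fun j => x (i, j)

/-- Row extraction as a linear map. -/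
def rowL (i : Fin 4) : (Fin 4 × Fin 4 → K) →ₗ[K] (Fin 4 → K) where
  toFun x := row x i
  map_add' x y := rfl
  map_smul' c x := rfl

/-- Auxiliary: `rowL_apply` (val-idea-18, SING-SIX classification). [folklore] -/
@[simp] theorem rowL_apply (i : Fin 4) (x : Fin 4 × Fin 4 → K) : rowL i x = row x i := rfl
/-- Auxiliary: `row_apply` (val-idea-18, SING-SIX classification). [folklore] -/
@[simp] theorem row_apply (x : Fin 4 × Fin 4 → K) (i j : Fin 4) : row x i j = x (i, j) := rfl
/-- Auxiliary: `row_add` (val-idea-18, SING-SIX classification). [folklore] -/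
theorem row_add (x y : Fin 4 × Fin 4 → K) (i : Fin 4) : row (x + y) i = row x i + row y i := rfl
/-- Auxiliary: `row_smul` (val-idea-18, SING-SIX classification). [folklore] -/
theorem row_smul (c : K) (x : Fin 4 × Fin 4 → K) (i : Fin 4) : row (c • x) i = c • row x i := rfl
/-- Auxiliary: `row_sub` (val-idea-18, SING-SIX classification). [folklore] -/
theorem row_sub (x y : Fin 4 × Fin 4 → K) (i : Fin 4) : row (x - y) i = row x i - row y i := rfl

/-- The `2 × 2` permanent of the pair `(v ; w)` on the columns `p, q`: `m_{pq}(v,w) = v_p w_q + v_q w_p`. -/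
def pairPerm (v w : Fin 4 → K) (p q : Fin 4) : K := v p * w q + v q * w p

/-- `v ⊥ w` (perm-orthogonal, memo §3.3): every `2 × 2` permanent of `(v ; w)` vanishes. -/
def PermOrth (v w : Fin 4 → K) : Prop := ∀ p q : Fin 4, p ≠ q → pairPerm v w p q = 0

/-- The symmetric trilinear form `T3 u v w l` = permanent of the `3 × 3` array with rows `u, v, w` on
the three columns `≠ l` (`permanent_submatrix_eq_T3`); `= (P(v,w) u)_l` in the memo's notation. -/
def T3 (u v w : Fin 4 → K) (l : Fin 4) : K :=
  u (l.succAbove 0) * (v (l.succAbove 1) * w (l.succAbove 2) + v (l.succAbove 2) * w (l.succAbove 1)) +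
  u (l.succAbove 1) * (v (l.succAbove 0) * w (l.succAbove 2) + v (l.succAbove 2) * w (l.succAbove 0)) +
  u (l.succAbove 2) * (v (l.succAbove 0) * w (l.succAbove 1) + v (l.succAbove 1) * w (l.succAbove 0))

/-- `α e_j + β e_c`. -/
def lvec (j c : Fin 4) (α β : K) : Fin 4 → K := α • Pi.single j 1 + β • Pi.single c 1

/-- Sign flip of the `c`-th coordinate (the memo's `σ = diag(1,-1)` on `span(e_j, e_c)`). -/
def flipAt (c : Fin 4) (v : Fin 4 → K) : Fin 4 → K := fun i => if i = c then -v i else v i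

/-- Two vectors with disjoint supports (the shapes `0, C1, C2, C3, C3′` of memo §3.2). -/
def DisjSupp (ℓ₁ ℓ₂ : Fin 4 → K) : Prop := ∀ i, ℓ₁ i = 0 ∨ ℓ₂ i = 0

/-- NORMAL FORM of the residue: `W ⊆ Sing`, `dim W = 6`, row `0 ≡ 0` on `W`. -/
def NormSix (W : Submodule K (Fin 4 × Fin 4 → K)) : Prop :=
  Sing3 W ∧ finrank K W = 6 ∧ ∀ x ∈ W, row x 0 = 0

/-- The seven-way conclusion of T6′ for `W`. -/
def Concl (W : Submodule K (Fin 4 × Fin 4 → K)) : Prop :=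
  InCross W ∨ TwoZeroRows W ∨ TwoZeroCols W ∨
    VLambdaRows W ∨ VGraphRows W ∨ VLambdaCols W ∨ VGraphCols W

/-! ### Proved basics: `T3` is the subpermanent; symmetric, trilinear; polarisation -/

/-- Auxiliary: `T3_swap₁₂` (val-idea-18, SING-SIX classification). [folklore] -/
theorem T3_swap₁₂ (u v w : Fin 4 → K) (l : Fin 4) : T3 u v w l = T3 v u w l := by
  unfold T3; ring
/-- Auxiliary: `T3_swap₂₃` (val-idea-18, SING-SIX classification). [folklore] -/
theorem T3_swap₂₃ (u v w : Fin 4 → K) (l : Fin 4) : T3 u v w l = T3 u w v l := by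
  unfold T3; ring
/-- Auxiliary: `T3_swap₁₃` (val-idea-18, SING-SIX classification). [folklore] -/
theorem T3_swap₁₃ (u v w : Fin 4 → K) (l : Fin 4) : T3 u v w l = T3 w v u l := by
  unfold T3; ring
/-- Auxiliary: `T3_add₁` (val-idea-18, SING-SIX classification). [folklore] -/
theorem T3_add₁ (u u' v w : Fin 4 → K) (l : Fin 4) : T3 (u + u') v w l = T3 u v w l + T3 u' v w l := by
  simp only [T3, Pi.add_apply]; ring
/-- Auxiliary: `T3_smul₁` (val-idea-18, SING-SIX classification). [folklore] -/
theorem T3_smul₁ (c : K) (u v w : Fin 4 → K) (l : Fin 4) : T3 (c • u) v w l = c * T3 u v w l := by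
  simp only [T3, Pi.smul_apply, smul_eq_mul]; ring
/-- Auxiliary: `T3_add₃` (val-idea-18, SING-SIX classification). [folklore] -/
theorem T3_add₃ (u v w w' : Fin 4 → K) (l : Fin 4) : T3 u v (w + w') l = T3 u v w l + T3 u v w' l := by
  simp only [T3, Pi.add_apply]; ring
/-- Auxiliary: `T3_smul₃` (val-idea-18, SING-SIX classification). [folklore] -/
theorem T3_smul₃ (c : K) (u v w : Fin 4 → K) (l : Fin 4) : T3 u v (c • w) l = c * T3 u v w l := by
  simp only [T3, Pi.smul_apply, smul_eq_mul]; ring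
/-- Auxiliary: `T3_add₂` (val-idea-18, SING-SIX classification). [folklore] -/
theorem T3_add₂ (u v v' w : Fin 4 → K) (l : Fin 4) : T3 u (v + v') w l = T3 u v w l + T3 u v' w l := by
  simp only [T3, Pi.add_apply]; ring
/-- Auxiliary: `T3_smul₂` (val-idea-18, SING-SIX classification). [folklore] -/
theorem T3_smul₂ (c : K) (u v w : Fin 4 → K) (l : Fin 4) : T3 u (c • v) w l = c * T3 u v w l := by
  simp only [T3, Pi.smul_apply, smul_eq_mul]; ring
/-- Auxiliary: `T3_zero₁` (val-idea-18, SING-SIX classification). [folklore] -/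
theorem T3_zero₁ (v w : Fin 4 → K) (l : Fin 4) : T3 0 v w l = 0 := by
  simp [T3]
/-- Auxiliary: `T3_zero₃` (val-idea-18, SING-SIX classification). [folklore] -/
theorem T3_zero₃ (u v : Fin 4 → K) (l : Fin 4) : T3 u v 0 l = 0 := by
  simp [T3]

/-- The `3 × 3` subpermanent of `x` on the rows `r₁, r₂, r₃` and the columns `≠ l` is `T3`. -/
theorem permanent_submatrix_eq_T3 (x : Fin 4 × Fin 4 → K) (r₁ r₂ r₃ l : Fin 4) :
    ((Matrix.of fun i j => x (i, j)).submatrix ![r₁, r₂, r₃] l.succAbove).permanent =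
      T3 (row x r₁) (row x r₂) (row x r₃) l := by
  rw [Matrix.permanent_fin_three_row]
  simp [Matrix.submatrix_apply, T3, row]

/-- `Sing3` yields `T3 = 0` on any three distinct rows. -/
theorem T3_eq_zero_of_sing3 {W : Submodule K (Fin 4 × Fin 4 → K)} (hS : Sing3 W)
    {x : Fin 4 × Fin 4 → K} (hx : x ∈ W) (r₁ r₂ r₃ : Fin 4) (h₁₂ : r₁ ≠ r₂) (h₁₃ : r₁ ≠ r₃)
    (h₂₃ : r₂ ≠ r₃) (l : Fin 4) : T3 (row x r₁) (row x r₂) (row x r₃) l = 0 := by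
  rw [← permanent_submatrix_eq_T3]
  refine hS x hx _ _ ?_ Fin.succAbove_right_injective
  intro a b hab
  fin_cases a <;> fin_cases b <;> simp_all

/-- **Polarisation** (memo §3.1): if `x, k ∈ W` and row `r` of `k` vanishes, then
`T3 (row x r) (row k s) (row k t) = 0` (the `t²`-coefficient of `T3` along `x + t k`). -/
theorem polar [CharZero K] {W : Submodule K (Fin 4 × Fin 4 → K)} (hS : Sing3 W)
    {r s t : Fin 4} (hrs : r ≠ s) (hrt : r ≠ t) (hst : s ≠ t)
    {x : Fin 4 × Fin 4 → K} (hx : x ∈ W) {k : Fin 4 × Fin 4 → K} (hk : k ∈ W)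
    (hkr : row k r = 0) (l : Fin 4) : T3 (row x r) (row k s) (row k t) l = 0 := by
  have h0 := T3_eq_zero_of_sing3 hS hx r s t hrs hrt hst l
  have h1 := T3_eq_zero_of_sing3 hS (W.add_mem hx hk) r s t hrs hrt hst l
  have h2 := T3_eq_zero_of_sing3 hS (W.sub_mem hx hk) r s t hrs hrt hst l
  rw [row_add, row_add, row_add, hkr, add_zero] at h1
  rw [row_sub, row_sub, row_sub, hkr, sub_zero] at h2
  have e1 : T3 (row x r) (row x s + row k s) (row x t + row k t) l =
      T3 (row x r) (row x s) (row x t) l + T3 (row x r) (row x s) (row k t) l +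
        T3 (row x r) (row k s) (row x t) l + T3 (row x r) (row k s) (row k t) l := by
    simp only [T3, Pi.add_apply]; ring
  have e2 : T3 (row x r) (row x s - row k s) (row x t - row k t) l =
      T3 (row x r) (row x s) (row x t) l - T3 (row x r) (row x s) (row k t) l -
        T3 (row x r) (row k s) (row x t) l + T3 (row x r) (row k s) (row k t) l := by
    simp only [T3, Pi.sub_apply]; ring
  have h3 : (2 : K) * T3 (row x r) (row k s) (row k t) l = 0 := by
    linear_combination h1 + h2 - 2 * h0 - e1 - e2
  rcases mul_eq_zero.mp h3 with h | h
  · exact absurd h two_ne_zero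
  · exact h

/-- `T3 u v w = 0` for all `u` forces `v ⊥ w` (take `u = e_j`). -/
theorem permOrth_of_T3 {v w : Fin 4 → K} (h : ∀ u l, T3 u v w l = 0) : PermOrth v w := by
  intro p q hpq
  fin_cases p <;> fin_cases q
  all_goals (first | exact absurd rfl hpq | skip)
  · have := h (Pi.single 2 1) 3; simpa [T3, Fin.succAbove, pairPerm, Pi.single_apply] using this
  · have := h (Pi.single 1 1) 3; simpa [T3, Fin.succAbove, pairPerm, Pi.single_apply] using this
  · have := h (Pi.single 1 1) 2; simpa [T3, Fin.succAbove, pairPerm, Pi.single_apply] using this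
  · have := h (Pi.single 2 1) 3; simpa [T3, Fin.succAbove, pairPerm, Pi.single_apply, add_comm, mul_comm] using this
  · have := h (Pi.single 0 1) 3; simpa [T3, Fin.succAbove, pairPerm, Pi.single_apply] using this
  · have := h (Pi.single 0 1) 2; simpa [T3, Fin.succAbove, pairPerm, Pi.single_apply] using this
  · have := h (Pi.single 1 1) 3; simpa [T3, Fin.succAbove, pairPerm, Pi.single_apply, add_comm, mul_comm] using this
  · have := h (Pi.single 0 1) 3; simpa [T3, Fin.succAbove, pairPerm, Pi.single_apply, add_comm, mul_comm] using this
  · have := h (Pi.single 0 1) 1; simpa [T3, Fin.succAbove, pairPerm, Pi.single_apply] using this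
  · have := h (Pi.single 1 1) 2; simpa [T3, Fin.succAbove, pairPerm, Pi.single_apply, add_comm, mul_comm] using this
  · have := h (Pi.single 0 1) 2; simpa [T3, Fin.succAbove, pairPerm, Pi.single_apply, add_comm, mul_comm] using this
  · have := h (Pi.single 0 1) 1; simpa [T3, Fin.succAbove, pairPerm, Pi.single_apply, add_comm, mul_comm] using this

/-- Conversely `v ⊥ w` gives `T3 u v w = 0`. -/
theorem T3_eq_zero_of_permOrth {v w : Fin 4 → K} (h : PermOrth v w) (u : Fin 4 → K) (l : Fin 4) :
    T3 u v w l = 0 := by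
  fin_cases l
  · have h12 := h 1 2 (by decide); have h13 := h 1 3 (by decide); have h23 := h 2 3 (by decide)
    simp only [pairPerm] at h12 h13 h23
    simp [T3, Fin.succAbove]
    linear_combination u 1 * h23 + u 2 * h13 + u 3 * h12
  · have h02 := h 0 2 (by decide); have h03 := h 0 3 (by decide); have h23 := h 2 3 (by decide)
    simp only [pairPerm] at h02 h03 h23
    simp [T3, Fin.succAbove]
    linear_combination u 0 * h23 + u 2 * h03 + u 3 * h02
  · have h01 := h 0 1 (by decide); have h03 := h 0 3 (by decide); have h13 := h 1 3 (by decide)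
    simp only [pairPerm] at h01 h03 h13
    simp [T3, Fin.succAbove]
    linear_combination u 0 * h13 + u 1 * h03 + u 3 * h01
  · have h01 := h 0 1 (by decide); have h02 := h 0 2 (by decide); have h12 := h 1 2 (by decide)
    simp only [pairPerm] at h01 h02 h12
    simp [T3, Fin.succAbove]
    linear_combination u 0 * h12 + u 1 * h02 + u 2 * h01

/-! ### Tool statements (self-contained linear algebra over `K⁴`; no `W`) -/

/-- **§3.3 PERM-ORTHOGONAL PAIRS** (S).  If `v ⊥ w` then `v = 0`, or `w = 0`, or both are supported on
a common pair of coordinates `{j, c}` (and then `v_j w_c + v_c w_j = 0` is the remaining content of `⊥`).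
Proof: if `v, w ≠ 0`, then for `p ∈ supp v ∌ q` the relation `m_{pq} = v_p w_q = 0` forces
`supp w ⊆ supp v`, so the two supports agree; on a common support of size `≥ 3` the ratios `w_p / v_p`
would be pairwise opposite — impossible in characteristic `≠ 2`.
[Check C8: exhaustive over `F₇`.] [folklore] -/
def PermOrthPairs (K : Type*) [Field K] : Prop :=
  ∀ v w : Fin 4 → K, PermOrth v w → v = 0 ∨ w = 0 ∨
    ∃ j c : Fin 4, j ≠ c ∧ ∀ i, i ≠ j → i ≠ c → v i = 0 ∧ w i = 0

/-- **§3.3 KERNEL-PLANE TYPES** (M; uses `PermOrthPairs`).  Let `D` be a linear space of `4 × 4`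
arrays supported on two rows `s ≠ t`, of dimension `≥ 2`, all of whose elements `d` have
`row_s d ⊥ row_t d`.  Then row `s` vanishes on `D`, or row `t` does, or `dim D = 2` and `D` is a RULING
PLANE of one quadric `Q_{jc} = {(v, w) ∈ span(e_j,e_c)² : v_j w_c + v_c w_j = 0}`: the PRODUCT plane
`K(αe_j+βe_c) × K(αe_j−βe_c)` (`(α,β) ≠ 0`; `αβ = 0` allowed) or the GRAPH plane
`Γ_e = {(v, e·σv)}`, `σ = diag(1,−1)` on `(j,c)`, `e ≠ 0`.  Proof: `D ⊆ {v=0} ∪ {w=0} ∪ ⋃ Q_{jc}`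
pointwise (`PermOrthPairs`); a vector space over the infinite field `K` is not a finite union of proper
subspaces, so `D` lies in `{v = 0}`, `{w = 0}` or one `span(e_j,e_c)²`, and there inside the rank-`4`
quadric `Q_{jc}`, whose maximal isotropic subspaces are the `2`-planes of its two rulings. [folklore] -/
def PerpPlanes (K : Type*) [Field K] : Prop :=
  ∀ (D : Submodule K (Fin 4 × Fin 4 → K)) (s t : Fin 4), s ≠ t →
    (∀ d ∈ D, ∀ i, i ≠ s → i ≠ t → row d i = 0) → 2 ≤ finrank K D →
    (∀ d ∈ D, PermOrth (row d s) (row d t)) →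
    (∀ d ∈ D, row d s = 0) ∨ (∀ d ∈ D, row d t = 0) ∨
    (finrank K D = 2 ∧
      ((∃ (j c : Fin 4) (α β : K), j ≠ c ∧ (α ≠ 0 ∨ β ≠ 0) ∧
          ∀ d, d ∈ D ↔ ((∀ i, i ≠ s → i ≠ t → row d i = 0) ∧
            (∃ μ : K, row d s = μ • lvec j c α β) ∧ (∃ ν : K, row d t = ν • lvec j c α (-β)))) ∨
       (∃ (j c : Fin 4) (e : K), j ≠ c ∧ e ≠ 0 ∧
          ∀ d, d ∈ D ↔ ((∀ i, i ≠ s → i ≠ t → row d i = 0) ∧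
            (∀ i, i ≠ j → i ≠ c → d (s, i) = 0 ∧ d (t, i) = 0) ∧
            d (t, j) = e * d (s, j) ∧ d (t, c) = -(e * d (s, c))))))

/-- **§3.2 THE SPACE `S(B)`** (M).  For a subspace `B ⊆ K⁴` of dimension `≥ 2`, the pairs `(v, w)`
with `P(v,w) B = 0` (i.e. `T3 b v w = 0` for all `b ∈ B`) have ALL their `2 × 2` permanents
proportional to ONE fixed pattern: there are `ℓ₁, ℓ₂` with disjoint supports (the disjoint-support
basis of `B^⊥` when it exists — shapes C1, C2, C3, C3′ — and `ℓ₁ = ℓ₂ = 0` otherwise, in particular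
whenever `dim B ≥ 3`) such that `m_{pq}(v,w) = μ · m_{ab}(ℓ₁,ℓ₂)` for `{a,b} = {p,q}ᶜ` (complementary
arrangement: `P(v,w) = μ (ℓ₁ℓ₂ᵀ + ℓ₂ℓ₁ᵀ)`).  Ingredients: `P(v,w)` is symmetric with zero diagonal;
such a matrix of rank `≤ 1` is `0` (R) and one of rank `2` is `ℓ₁ℓ₂ᵀ + ℓ₂ℓ₁ᵀ` with `ℓ₁, ℓ₂` of disjoint
supports (H); `B ⊆ ker P(v,w)`.  [Check 3.2′: 655 random/sparse planes + all shapes.] [folklore] -/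
def SBShape (K : Type*) [Field K] : Prop :=
  ∀ B : Submodule K (Fin 4 → K), 2 ≤ finrank K B →
    ∃ ℓ₁ ℓ₂ : Fin 4 → K, DisjSupp ℓ₁ ℓ₂ ∧
      ∀ v w : Fin 4 → K, (∀ b ∈ B, ∀ l, T3 b v w l = 0) →
        ∃ μ : K, ∀ p q a b : Fin 4, p ≠ q → a ≠ b → a ≠ p → a ≠ q → b ≠ p → b ≠ q →
          pairPerm v w p q = μ * pairPerm ℓ₁ ℓ₂ a b

/-- **§3.4 LEMMA Φ** (M; a linear system in the `16` entries of `φ`, shape by shape).  If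
`φ : K⁴ → K⁴` is linear and, for every `u`, the `2 × 2` permanents of `(u, φu)` are proportional to the
fixed complementary pattern of a disjoint-support pair `(ℓ₁, ℓ₂)` (shapes `0, C1, C2, C3, C3′`), then
`φ = 0`.  Proof: polarise `uφ(u)ᵀ + φ(u)uᵀ ≡ μ(u) M₀ (mod diagonal)` at `(e_i, e_j)` and read off the
entries (memo §3.4 (1)–(4)); uses characteristic `≠ 2`.  [Checks C7 and 3.4′.] [folklore] -/
def LemmaPhi (K : Type*) [Field K] : Prop :=
  ∀ (φ : (Fin 4 → K) →ₗ[K] (Fin 4 → K)) (ℓ₁ ℓ₂ : Fin 4 → K), DisjSupp ℓ₁ ℓ₂ →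
    (∀ u, ∃ μ : K, ∀ p q a b : Fin 4, p ≠ q → a ≠ b → a ≠ p → a ≠ q → b ≠ p → b ≠ q →
        pairPerm u (φ u) p q = μ * pairPerm ℓ₁ ℓ₂ a b) → φ = 0

end Summit.ValiantsHypothesis.ValiantsHypothesis.Theorems.SymPencilSingSixClassification

end
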